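import Mathlib
import HarnessLib
import Literature.MathematicalPhysics.QuantumLattice.HubbardEffectiveActionCTSpinFlip
import Literature.MathematicalPhysics.QuantumLattice.HubbardEffectiveActionCTTimeReversal
import Summits.HubbardSuperconductivity.HubbardSuperconductivity.Theorems.KLProgrammeKLRegimeEngineSelfEnergyGeometric
import Summits.HubbardSuperconductivity.HubbardSuperconductivity.Theorems.KLProgrammeKLRegimeSplitPredicates

/-!
# Route `KLProgramme` — crux K3, ENGINE child (`KLRegimeEngineV7 := EngineP3 klPredsV7 klWindowC`,
# stmt-HubbardSuperconductivity-19662): clause (E0) `SelfEnergySymmetric` of the engine slot `EngineBoundsAtV5S … n` PROVED at every scale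

Cell gate-hubbard-kl, seat p3 (g4); T3RUNG item 1 (HOME/p1/T3RUNG-SCOPE.md §0 item 1) — the model-symmetry clause that opens every
version of the engine slot (`EngineBoundsAtV3/V4/V4S/V5S = SelfEnergySymmetric ∧ …`, `KLProgrammeKLRegimeSplitPredicates.lean` l.210):
for every volume, temperature, coupling, chemical potential, frame `K` and scale `n`, the self-energy of the scale-`n` action
`klSelfEnergy … n = selfEnergy (hubbardEffectiveActionCT L M β U μ 0 K (klScale e₀ n))` satisfies
(i) `Σ_n((−ω₀, k⃗), σ) = conj Σ_n((ω₀, k⃗), σ)` — time reversal = frequency reflection ∘ coefficient conjugation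
(`Literature/…/HubbardEffectiveActionCTTimeReversal.lean`, on `GrassmannConjugationEffectiveAction.lean`; BGM 2006 §2.1 (5), §2.3);
(ii) `Σ_n((ω₀, k⃗), σ) = Σ_n((ω₀, k⃗), ↑)` — spin exchange (`HubbardEffectiveActionCTSpinFlip.lean`; BGM §2.1 (1));
(iii) `Σ_n((ω₀, −k⃗), σ) = Σ_n((ω₀, k⃗), σ)` and (iv) `Σ_n((ω₀, γk⃗), σ) = Σ_n((ω₀, k⃗), σ)`, `γ ∈ D₄` — the point group
(`KLProgrammeKLRegimeEngineSelfEnergyGeometric.lean`, on `HubbardEffectiveActionCTSymmetry.lean`; BGM §2.1 (4)).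
Main statement **`selfEnergySymmetric_all`**: `SelfEnergySymmetric L M β U μ K n` — unconditionally, no smallness, no analysis.
Everything is proved; no definitions.
-/

noncomputable section

namespace Summit.HubbardSuperconductivity.HubbardSuperconductivity.Theorems.KLRegimeSplit

set_option linter.dupNamespace false -- summit = problem name (single-conjunct summit), D-0017

open scoped ComplexConjugate
open Literature.MathematicalPhysics.QuantumLattice Literature.Probability.LatticeModels
open Summit.HubbardSuperconductivity.HubbardSuperconductivity.Theorems.KLProgrammeLegKernels

section Model

variable (L M : ℕ) [NeZero L]

/-- **Conjunct (i) of (E0) at every scale: reality / time reversal**, `Σ_n((rev ω, k⃗), σ) = conj Σ_n((ω, k⃗), σ)` for every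
frequency `ω`, spin `σ`, frame `K` and cutoff parameter `e₀`. -/
theorem klSelfEnergy_revFreq (β U μ : ℝ) (K : TrigPolyC4v) (e₀ : ℝ) (n : ℕ) (ω : MatsubaraIdx M) (k : TorusSite 2 L) (σ : Fin 2) :
    klSelfEnergy L M β U μ K e₀ n (ω.rev, k) σ = conj (klSelfEnergy L M β U μ K e₀ n (ω, k) σ) :=
  selfEnergy_hubbardEffectiveActionCT_revFreq L M β U μ 0 K (klScale e₀ n) ω k σ

/-- **Conjunct (ii) of (E0) at every scale: spin independence**, `Σ_n(k, σ) = Σ_n(k, ↑)`. -/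
theorem klSelfEnergy_spin_eq (β U μ : ℝ) (K : TrigPolyC4v) (e₀ : ℝ) (n : ℕ) (k : FreqMomentum L M) (σ : Fin 2) :
    klSelfEnergy L M β U μ K e₀ n k σ = klSelfEnergy L M β U μ K e₀ n k 0 :=
  selfEnergy_hubbardEffectiveActionCT_spin_eq L M β U μ K (klScale e₀ n) k σ

/-- **(E0) `SelfEnergySymmetric L M β U μ K n` holds at every scale `n`** — the opening clause of the engine slot
`EngineBoundsAtV5S … n` of the bundle of record `klPredsV7` (child `KLRegimeEngineV7`), for all parameters: time reversal, spin
exchange, parity and the point group `D₄` are symmetries of the seedless countertermed effective action, and the self-energy is read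
from its kernels covariantly. -/
theorem selfEnergySymmetric_all [NeZero M] (β U μ : ℝ) (K : TrigPolyC4v) (n : ℕ) : SelfEnergySymmetric L M β U μ K n :=
  fun k σ =>
    ⟨klSelfEnergy_revFreq L M β U μ K klE0 n (omega0 M) k σ, klSelfEnergy_spin_eq L M β U μ K klE0 n (omega0 M, k) σ,
      klSelfEnergy_neg L M β U μ K klE0 n (omega0 M) k σ, fun g => klSelfEnergy_d4Site L M β U μ K klE0 n g (omega0 M) k σ⟩

/-- The same for the whole scale ladder at once (the form the engine child's strong induction reads). -/
theorem selfEnergySymmetric_forall [NeZero M] (β U μ : ℝ) (K : TrigPolyC4v) : ∀ n : ℕ, SelfEnergySymmetric L M β U μ K n :=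
  fun n => selfEnergySymmetric_all L M β U μ K n

end Model

end Summit.HubbardSuperconductivity.HubbardSuperconductivity.Theorems.KLRegimeSplit

end
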